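import Literature.AnabelianGeometry.AbsoluteAnabelian.AbsTopIProp410CoFreeBridge
import Literature.AnabelianGeometry.AbsoluteAnabelian.AbsTopIProp410SubRows
import Literature.AnabelianGeometry.AbsoluteAnabelian.AbsTopI.CharOpenBasis
import HarnessLib

/-!
# [AbsTopI] Prop 4.10 (iii): one cofinality direction at the construction, REDUCED to printed inputs
# (proof-only)

S. Mochizuki, *Topics in Absolute Anabelian Geometry I: Generalities* [AbsTopI] (J. Math. Sci.
Univ. Tokyo 19 (2012)), §0 p. 8 (the `(Q, Δ)`-co-free completion over "the characteristic open
subgroups of `Δ` of finite index"; p. 9: for topologically finitely generated groups these form a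
basis) and Prop 4.10 (iii) p. 60 (manuscript pagination, lit key `paper:url-11ac98ba15fc`, read on
the page).

`coFreeCofinalImAlong_right_of`: conjunct 2 of abc-iut-L4-t13 gen 3's `CoFreeCofinalImAlong E`
(`AbsTopIProp410CoFreeBridge.lean`: for every Y-index `H′` an X-index `H` with
`X̂-kernel(H) ≤ Ŷ-kernel(H′)` in `Π̂_Y`) — the direction that DEFINES the comparison map of
`CoFreeCompletionComparison.lean` and one of the inputs of `prop410iiiAt_of_rows`
(`AbsTopIProp410iiiAssembly.lean`) — FOLLOWS from:
* the INCLUSION half of row iii.L04 over the topological-characteristic indices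
  (`f(f⁻¹(H′)^{co-fr}) ⊆ H′^{co-fr}`: "filling a cusp, graph coverings pull back to graph-dominated
  coverings" — hypothesis `hcompat`),
* a profinite completion `ι : Δ^tp_X → Δ̂` of the geometric tempered group ([SemiAnbd] §6
  `IsProfiniteCompletion`, abc-iut-L3; e.g. `X.deltaToHat` under L3's hypothesis shape) whose `Δ̂` is
  topologically finitely generated (gen 4's `CharOpenBasis.lean`: then the characteristic open
  subgroups of finite index of `Δ^tp_X` are COFINAL, [AbsTopI] §0 p. 9),
because `f⁻¹(H′)` is open of finite index in `Δ^tp_X` (gen 4's `isOpenFiniteIndexInDelta_comap`) and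
`H ↦ H^{co-fr}` is monotone (`cofreeCore_mono`, Nielsen–Schreier).
HONEST FRAMING: refereed prerequisite paper; the inputs are hypotheses; nothing here bears on
[IUTchIII] Cor 3.12; typed ≠ proved.
-/

noncomputable section

open Topology

namespace Literature.AnabelianGeometry.AbsoluteAnabelian.AbsTopI.Prop410

open Literature.AnabelianGeometry.SemiGraphs
open Literature.AnabelianGeometry.AbsoluteAnabelian.AbsTopI

variable {p : ℕ} [Fact p.Prime]

/-- Monotonicity of the co-free kernel in its generating set: if `ρ₁(H₁^{co-fr}) ⊆ ρ₂(H₂^{co-fr})`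
inside the same `Q`, then `coFreeKernel ρ₁ H₁ ≤ coFreeKernel ρ₂ H₂`. [cite: MochizukiAbsTopI2012, §0 p.8] -/
theorem coFreeKernel_le_of_image_subset {P₁ P₂ Q : Type*} [Group P₁] [TopologicalSpace P₁]
    [Group P₂] [TopologicalSpace P₂] [Group Q] [TopologicalSpace Q] [IsTopologicalGroup Q]
    (ρ₁ : P₁ →ₜ* Q) (ρ₂ : P₂ →ₜ* Q) {H₁ : Subgroup P₁} {H₂ : Subgroup P₂}
    (h : ρ₁ '' (cofreeCore H₁ : Set P₁) ⊆ ρ₂ '' (cofreeCore H₂ : Set P₂)) :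
    coFreeKernel ρ₁ H₁ ≤ coFreeKernel ρ₂ H₂ :=
  Subgroup.topologicalClosure_mono (Subgroup.normalClosure_mono h)

/-- **Conjunct 2 of `CoFreeCofinalImAlong E` from printed-shape inputs**: the inclusion half of
iii.L04 over the topological-characteristic indices, a profinite completion of `Δ^tp_X` with
topologically finitely generated target ⟹ for every Y-index `H′` an X-index `H` with
`X̂-kernel(H) ≤ Ŷ-kernel(H′)` in `Π̂_Y`. [cite: MochizukiAbsTopI2012, Prop 4.10 (iii) p.60] -/
theorem coFreeCofinalImAlong_right_of {X Y : TemperedCurve p} (E : DeCuspidalization X Y)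
    {Dhat : Type} [Group Dhat] [TopologicalSpace Dhat] [IsTopologicalGroup Dhat]
    {ι : X.DeltaTemp →ₜ* Dhat} (hι : IsProfiniteCompletion ι)
    (hfg : IsTopologicallyFinitelyGenerated Dhat)
    (hcompat : ∀ H' : CharOpenSubgroup Y.DeltaTemp,
      (cofreeCore (H'.toSubgroup.comap E.f.toMonoidHom)).map E.f.toMonoidHom ≤
        cofreeCore H'.toSubgroup)
    (H' : CharOpenSubgroup Y.DeltaTemp) :
    ∃ H : CharOpenSubgroup X.DeltaTemp,
      coFreeKernel (E.fHat.comp X.toHat) H.toSubgroup ≤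
        coFreeKernel ((ContinuousMonoidHom.id Y.PiHat).comp Y.toHat) H'.toSubgroup := by
  -- `U := f⁻¹(H′)` is open of finite index in `Δ^tp_X`
  have hU : IsOpenFiniteIndexInDelta X (H'.toSubgroup.comap E.f.toMonoidHom) :=
    E.isOpenFiniteIndexInDelta_comap ⟨H'.le, H'.isOpen, H'.finiteIndex⟩
  obtain ⟨_, hUo, hUi⟩ := hU
  haveI := hUi
  -- a characteristic open subgroup of finite index `H ≤ U` (§0 p. 9 via the completion)
  obtain ⟨H, hHU⟩ :=
    CharOpenSubgroup.exists_le_of_completion hι hfg (H'.toSubgroup.comap E.f.toMonoidHom) hUo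
  refine ⟨H, coFreeKernel_le_of_image_subset _ _ ?_⟩
  rintro _ ⟨x, hx, rfl⟩
  have hxU : x ∈ cofreeCore (H'.toSubgroup.comap E.f.toMonoidHom) := cofreeCore_mono hHU hx
  have hfx : E.f x ∈ cofreeCore H'.toSubgroup := hcompat H' ⟨x, hxU, rfl⟩
  refine ⟨E.f x, hfx, ?_⟩
  change Y.toHat (E.f x) = E.fHat (X.toHat x)
  exact E.toHat_comp x

/-- The same with L3's own profinite-completion datum `Δ^tp_X → Δ_X` (`TemperedCurve.deltaToHat`,
under the hypothesis shape `IsProfiniteCompletion X.deltaToHat` used in the [SemiAnbd] §6 files)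
and `Δ_X` topologically finitely generated. [cite: MochizukiAbsTopI2012, Prop 4.10 (iii) p.60] -/
theorem coFreeCofinalImAlong_right_of_deltaToHat {X Y : TemperedCurve p} (E : DeCuspidalization X Y)
    (hΔ : IsProfiniteCompletion X.deltaToHat)
    (hfg : IsTopologicallyFinitelyGenerated X.DeltaHat)
    (hcompat : ∀ H' : CharOpenSubgroup Y.DeltaTemp,
      (cofreeCore (H'.toSubgroup.comap E.f.toMonoidHom)).map E.f.toMonoidHom ≤
        cofreeCore H'.toSubgroup) :
    ∀ H' : CharOpenSubgroup Y.DeltaTemp, ∃ H : CharOpenSubgroup X.DeltaTemp,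
      coFreeKernel (E.fHat.comp X.toHat) H.toSubgroup ≤
        coFreeKernel ((ContinuousMonoidHom.id Y.PiHat).comp Y.toHat) H'.toSubgroup :=
  fun H' => coFreeCofinalImAlong_right_of E hΔ hfg hcompat H'

end Literature.AnabelianGeometry.AbsoluteAnabelian.AbsTopI.Prop410
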